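import Literature.Analysis.SegalBargmann.HermiteMultiplierOperators
import HarnessLib

/-!
# The Fourier transform and the oscillator torus as Hermite multipliers on `𝒮(ℝⁿ)` (Folland 1989, §1.7 and Ch. 4 §4)

Topic `Analysis/SegalBargmann`; namespace `Literature.Analysis.SegalBargmann`.  Continuation of
`Literature.Analysis.SegalBargmann.HermiteMultiplierOperators` (`T_m f = Σ_β m_β c_β(f) h_β`, a continuous operator on
`𝒮(ℝ^σ, ℂ)` for every multiplier of polynomial growth).  Two unimodular multipliers:

* `(−i)^{|β|}`: **the Fourier transform IS the Hermite multiplier `(−i)^{|β|}`** on `𝒮(ℝ^σ, ℂ)`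
  (`fourier_eq_hermiteMultiplierCLM`; `𝓕 h_β = (−i)^{|β|} h_β` plus the `N`-representation theorem);
* `e^{iθ·β}`, `θ ∈ ℝ^σ`: **the oscillator torus acting on `𝒮(ℝ^σ, ℂ)` by continuous operators** `torusOpCLM θ = e^{iθ·N}`
  (`N = (N_j)` the number operators of `HermiteOscillator`): `e^{iθ·N} h_α = e^{iθ·α} h_α` (`torusOpCLM_herm`),
  `c_α(e^{iθ·N} f) = e^{iθ·α} c_α(f)`, the group law `e^{i(θ+θ')·N} = e^{iθ·N} e^{iθ'·N}` (`torusOpCLM_add`), `e^{i0·N} = 1`,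
  commutativity, and commutation with `𝓕` — the GROUP-LEVEL form, on the smooth vectors `𝒮(ℝ^σ)`, of the compact torus
  of the metaplectic representation (Folland Ch. 4 §4, `μ(e^{t𝒜})` for `𝒜` in the Cartan of `sp ∩ o(2n)`), whose
  infinitesimal generators `iN_j` were put on `𝒮` in `HermiteOscillator`.

Everything is proved from Mathlib and the imported tree files; no cited fact is used as a hypothesis.

## References

* G. B. Folland, *Harmonic Analysis in Phase Space*, Annals of Mathematics Studies 122, Princeton UP (1989), §1.7,
  Prop. (4.39) and Ch. 4 §4.  [cite: Folland1989, §1.7]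
* M. Reed, B. Simon, *Methods of Modern Mathematical Physics I*, Theorem V.13 and the Appendix to §V.3.

## Provenance

Written for the tree under the LEAN-IN-TREE rule (2026-08-18) by the pub-hodgecm formalisation cell (model-construction
sub-cell, seat mc-binder-2).
-/

set_option autoImplicit false

noncomputable section

open MvPolynomial Complex SchwartzMap MeasureTheory
open scoped BigOperators Real

namespace Literature.Analysis.SegalBargmann

variable {σ : Type*} [Fintype σ] [DecidableEq σ]

/-! ## §1  The Fourier transform and the oscillator torus as Hermite multipliers -/

section Torus

omit [Fintype σ] [DecidableEq σ] in
/-- The Fourier multiplier `(−i)^{|β|}` is unimodular. [folklore] -/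
theorem isPolyBounded_negI_pow : IsPolyBounded (fun β : σ →₀ ℕ => (-I) ^ β.degree) 0 1 :=
  isPolyBounded_of_norm_le fun β => by rw [norm_pow, norm_neg, Complex.norm_I, one_pow]

/-- **The Fourier transform is the Hermite multiplier `(−i)^{|β|}`** on `𝒮(ℝ^σ, ℂ)` (`c_α(𝓕f) = (−i)^{|α|} c_α(f)` and a
Schwartz function is determined by its Hermite coefficients). [cite: Folland1989, §1.7] -/
theorem fourier_eq_hermiteMultiplierCLM (f : 𝓢(EuclideanSpace ℝ σ, ℂ)) :
    FourierTransform.fourier f = hermiteMultiplierCLM (fun β : σ →₀ ℕ => (-I) ^ β.degree) isPolyBounded_negI_pow f := by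
  refine ext_hermiteCoeff fun β => ?_
  rw [hermiteCoeff_hermiteMultiplierCLM, hermiteCoeff_fourier]

/-- **The torus phase `e^{i θ·β}`**, `θ ∈ ℝ^σ`, `β ∈ ℕ^σ`. [folklore] -/
def torusPhase (θ : σ → ℝ) (β : σ →₀ ℕ) : ℂ :=
  Complex.exp (((∑ j : σ, θ j * (β j : ℝ) : ℝ) : ℂ) * I)

omit [DecidableEq σ] in
/-- `|e^{iθ·β}| = 1`. [folklore] -/
theorem norm_torusPhase (θ : σ → ℝ) (β : σ →₀ ℕ) : ‖torusPhase θ β‖ = 1 :=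
  Complex.norm_exp_ofReal_mul_I _

omit [DecidableEq σ] in
/-- The torus phases are unimodular multipliers. [folklore] -/
theorem isPolyBounded_torusPhase (θ : σ → ℝ) : IsPolyBounded (torusPhase θ) 0 1 :=
  isPolyBounded_of_norm_le fun β => (norm_torusPhase θ β).le

omit [DecidableEq σ] in
/-- `e^{i 0·β} = 1`. [folklore] -/
theorem torusPhase_zero (β : σ →₀ ℕ) : torusPhase (0 : σ → ℝ) β = 1 := by
  simp [torusPhase]

omit [DecidableEq σ] in
/-- `e^{i(θ+θ')·β} = e^{iθ·β} e^{iθ'·β}`. [folklore] -/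
theorem torusPhase_add (θ θ' : σ → ℝ) (β : σ →₀ ℕ) :
    torusPhase (θ + θ') β = torusPhase θ β * torusPhase θ' β := by
  rw [torusPhase, torusPhase, torusPhase, ← Complex.exp_add]
  congr 1
  simp only [Pi.add_apply, add_mul, Finset.sum_add_distrib]
  push_cast
  ring

/-- **The oscillator torus acting on `𝒮(ℝ^σ, ℂ)`**: `U(θ) f = Σ_β e^{iθ·β} c_β(f) h_β`, a continuous linear operator for
every `θ ∈ ℝ^σ` (Folland §4.4, the metaplectic representation on the compact torus, on the smooth vectors).
[cite: Folland1989, §1.7] -/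
def torusOpCLM (θ : σ → ℝ) : 𝓢(EuclideanSpace ℝ σ, ℂ) →L[ℂ] 𝓢(EuclideanSpace ℝ σ, ℂ) :=
  hermiteMultiplierCLM (torusPhase θ) (isPolyBounded_torusPhase θ)

/-- **`U(θ) h_α = e^{iθ·α} h_α`.** [cite: Folland1989, §1.7] -/
theorem torusOpCLM_herm (θ : σ → ℝ) (α : σ →₀ ℕ) :
    torusOpCLM θ (hermiteSchwartz (herm α)) = torusPhase θ α • hermiteSchwartz (herm α) :=
  hermiteMultiplierCLM_herm _ _ α

/-- `c_α(U(θ) f) = e^{iθ·α} c_α(f)`. [folklore] -/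
@[simp]
theorem hermiteCoeff_torusOpCLM (θ : σ → ℝ) (f : 𝓢(EuclideanSpace ℝ σ, ℂ)) (α : σ →₀ ℕ) :
    hermiteCoeff α (torusOpCLM θ f) = torusPhase θ α * hermiteCoeff α f :=
  hermiteCoeff_hermiteMultiplierCLM _ _ f α

/-- **`U(0) = 1`.** [folklore] -/
theorem torusOpCLM_zero : torusOpCLM (0 : σ → ℝ) = ContinuousLinearMap.id ℂ (𝓢(EuclideanSpace ℝ σ, ℂ)) := by
  refine ContinuousLinearMap.ext fun f => ext_hermiteCoeff fun β => ?_
  rw [hermiteCoeff_torusOpCLM, torusPhase_zero, one_mul, ContinuousLinearMap.id_apply]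

/-- **The group law `U(θ + θ') = U(θ) U(θ')`.** [cite: Folland1989, §1.7] -/
theorem torusOpCLM_add (θ θ' : σ → ℝ) : torusOpCLM (θ + θ') = (torusOpCLM θ).comp (torusOpCLM θ') := by
  refine ContinuousLinearMap.ext fun f => ext_hermiteCoeff fun β => ?_
  rw [hermiteCoeff_torusOpCLM, ContinuousLinearMap.comp_apply, hermiteCoeff_torusOpCLM, hermiteCoeff_torusOpCLM,
    torusPhase_add, mul_assoc]

/-- The torus operators commute. [folklore] -/
theorem torusOpCLM_comm (θ θ' : σ → ℝ) : (torusOpCLM θ).comp (torusOpCLM θ') = (torusOpCLM θ').comp (torusOpCLM θ) := by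
  rw [← torusOpCLM_add, ← torusOpCLM_add, add_comm]

/-- The torus commutes with the Fourier transform (both are Hermite multipliers). [folklore] -/
theorem torusOpCLM_fourier (θ : σ → ℝ) (f : 𝓢(EuclideanSpace ℝ σ, ℂ)) :
    torusOpCLM θ (FourierTransform.fourier f) = FourierTransform.fourier (torusOpCLM θ f) := by
  rw [fourier_eq_hermiteMultiplierCLM, fourier_eq_hermiteMultiplierCLM, torusOpCLM]
  exact hermiteMultiplierCLM_comm _ _ _ f

end Torus

end Literature.Analysis.SegalBargmann

end
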